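import Summits.HodgeConjecture.HodgeConjecture.Theorems.F0P3cStCharTSShellOrbitalG       -- ★ p849606 (LH2-p03): `exists_isOpen_subgroup_subset_cmBorelM`
import Literature.NumberTheory.Automorphic.CMLocalRingModulusContinuous                  -- ★ `continuous_cmXiTorusChar_fst`
import Literature.NumberTheory.Automorphic.CMPrincipalSeriesJacquetEvalOne               -- ★ `continuous_cmTorusCharPair_apply`
import Literature.NumberTheory.Automorphic.UnitaryGroupPrincipalSeriesExponents          -- ★ `cmXiTorusChar_eq_cmTorusCharPair` (`rfl`)
import Literature.NumberTheory.Automorphic.TorusCharacterLocalComponents                 -- ★ `continuous_semilocalComponent`, `continuous_torusLocalComponent`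
import Literature.NumberTheory.Rogawski1990.OneDimAutRepH                                -- ★ `OneDimAutRepH` (`ξ = (η, ψ)`)
import HarnessLib

/-!
# F0 · P3c · line LH6 «StCharTS» — road (D) «DEEP-FL», brick «XI-CONT + M-NONARCH★»: `χ_ξ` is continuous at `1` as a `ℂˣ`-valued character of `T₃`, and `T₃` is a
# non-archimedean group (the two inputs of STEP U of the (D-c) head)

Cell `pub/hodgecm-mathlib`, crux H413 = `stmt-HodgeConjecture-24833` (lane `--supports … --as helper`), route HCCMUnconditional; hand F0P3-p01 (g20) on the road-(D)
owner's deal (LH6-p04 (g3), 2026-09-02 07:23Z «TAKE XI-CONT + M-NONARCH★»).  THEOREMS ONLY (no `instance` keyword, no definition ∕ notation ∕ named fact), sorry-free,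
★-only imports.  HONEST LABEL: HC_CM is proved only modulo the 7 printed citations (2 remaining: hLiu418 = stmt-HodgeConjecture-24832, h413 = stmt-HodgeConjecture-24833) until
rung 0 closes; count-neutral plumbing for the (D-c) head «XIG-ASSEMBLY» (STEP U: the neighbourhood `U ∋ 1` on which `χ_ξ|_{T₃}`, via ★ p849929
`F0P3cStCharTSCharTrivialNhds.exists_nhds_forall_subtype_apply_eq_one (M) [NonarchimedeanGroup M] (χ) (hχ : ContinuousAt χ 1)`).

THE MATHEMATICS ([Rogawski1990, §12.2 (2) p. 174]; [TateThesis1967, §2.3]).  `χ_ξ = (η̃₁·μ_v·‖·‖^{1∕2}, η₂)` on `T₃ = {d(α, β, ᾱ⁻¹)}` (★ `cmXiTorusChar` = ★ `cmTorusCharPair …`,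
`rfl`); its first coordinate is continuous (★ `continuous_cmXiTorusChar_fst`) when `μ_v` (★ `continuous_semilocalComponent`) and `η₁ = ξ.η_v` (★ `continuous_torusLocalComponent`)
are, the second is `ξ.ψ_v`; so `t ↦ χ_ξ(t) ∈ ℂ` is continuous (★ `continuous_cmTorusCharPair_apply`), and a `ℂ`-continuous HOMOMORPHISM into `ℂˣ` is `ℂˣ`-continuous
(`(χ t)⁻¹ = χ(t⁻¹)`, Mathlib `Units.continuous_iff`).  `T₃ ≤ U(Φ₃)(L⁺_v)` is non-archimedean because `U(Φ₃)(L⁺_v)` is (★ `nonarchimedeanGroup_cmLocal`; ★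
`exists_isOpen_subgroup_subset_cmBorelM` gives the open subgroups).

* §1 `continuous_unitsHom_of_continuous_val` (generic), `continuous_cmXiTorusChar_apply`, `continuous_cmXiTorusChar`, **`continuousAt_cmXiTorusChar_one`** (the `hχ` of
  ★ p849929 at `χ_ξ` for `μ : HeckeCharacter L`, `ξ : OneDimAutRepH L`);
* §2 **`nonarchimedeanGroup_cmBorelM`** (`NonarchimedeanGroup ↥(cmBorelTriple L 3 v).M`, as a THEOREM).

## References
* [Rogawski1990] J. D. Rogawski, *Automorphic Representations of Unitary Groups in Three Variables*, Ann. of Math. Stud. 123 (1990): §12.2 (2) p. 174; §12.7 Lemma 12.7.3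
  (proof) p. 195.
* [TateThesis1967] J. Tate, *Fourier analysis in number fields and Hecke's zeta-functions*, in Cassels–Fröhlich (1967), §2.3 (quasi-characters are locally constant on units).
* [PlatonovRapinchuk1994] V. Platonov, A. Rapinchuk, *Algebraic Groups and Number Theory* (1994), §3.3 (totally disconnected locally compact groups).
-/

set_option autoImplicit false
-- the mandated namespace has the single-problem summit's repeated segment (`HodgeConjecture.HodgeConjecture`)
set_option linter.dupNamespace false

noncomputable section

open NumberField IsDedekindDomain Topology Filter
open scoped Matrix MatrixGroups
open Literature.NumberTheory Literature.NumberTheory.Automorphic Literature.NumberTheory.Automorphic.UnitaryGroup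
open Literature.NumberTheory.GaloisRepresentations Literature.NumberTheory.Rogawski1990

namespace Summit.HodgeConjecture.HodgeConjecture.Cruxes.H413.F0P3cStCharTSXiCont

/-! ## §1 `χ_ξ` is continuous (hence continuous at `1`) as a map `T₃ → ℂˣ` -/

/-- A homomorphism into `ℂˣ` that is continuous as a `ℂ`-valued map is continuous as a `ℂˣ`-valued map (`(χ t)⁻¹ = χ(t⁻¹)`; Mathlib `Units.continuous_iff`).
[cite: TateThesis1967, §2.3] -/
theorem continuous_unitsHom_of_continuous_val {T : Type*} [Group T] [TopologicalSpace T] [ContinuousInv T] (χ : T →* ℂˣ)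
    (h : Continuous fun t => ((χ t : ℂˣ) : ℂ)) : Continuous (χ : T → ℂˣ) := by
  refine Units.continuous_iff.2 ⟨h, ?_⟩
  have hinv : (fun t => (((χ t)⁻¹ : ℂˣ) : ℂ)) = (fun t => ((χ t : ℂˣ) : ℂ)) ∘ fun t => t⁻¹ := by
    funext t
    simp only [Function.comp_apply, map_inv]
  rw [hinv]
  exact h.comp continuous_inv

variable (L : Type) [Field L] [NumberField L] [IsCMField L] (v : HeightOneSpectrum (𝓞 ↥(maximalRealSubfield L)))

/-- **`t ↦ χ_ξ(t) ∈ ℂ` is continuous on `T₃`** for continuous `μ_v, η₁, η₂` (★ `cmXiTorusChar = cmTorusCharPair (η̃₁ μ ‖·‖^{1∕2}) η₂` definitionally; ★ `continuous_cmXiTorusChar_fst`,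
★ `continuous_cmTorusCharPair_apply`). [cite: Rogawski1990, §12.2 (2) p. 174] -/
theorem continuous_cmXiTorusChar_apply (μv : (LocalRing L v)ˣ →* ℂˣ) (η₁ η₂ : ↥(normOneUnits (conjLocal L (IsCMField.complexConj L) v)) →* ℂˣ)
    (hμc : Continuous fun x => ((μv x : ℂˣ) : ℂ)) (h1c : Continuous fun x => ((η₁ x : ℂˣ) : ℂ)) (h2c : Continuous fun x => ((η₂ x : ℂˣ) : ℂ)) :
    Continuous fun t => ((cmXiTorusChar L v μv η₁ η₂ t : ℂˣ) : ℂ) := by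
  rw [cmXiTorusChar_eq_cmTorusCharPair]
  exact continuous_cmTorusCharPair_apply L v _ η₂ (continuous_cmXiTorusChar_fst L v μv η₁ hμc h1c) h2c

/-- **`χ_ξ : T₃ → ℂˣ` is continuous** for continuous `μ_v, η₁, η₂`. [cite: Rogawski1990, §12.2 (2) p. 174] [cite: TateThesis1967, §2.3] -/
theorem continuous_cmXiTorusChar (μv : (LocalRing L v)ˣ →* ℂˣ) (η₁ η₂ : ↥(normOneUnits (conjLocal L (IsCMField.complexConj L) v)) →* ℂˣ)
    (hμc : Continuous fun x => ((μv x : ℂˣ) : ℂ)) (h1c : Continuous fun x => ((η₁ x : ℂˣ) : ℂ)) (h2c : Continuous fun x => ((η₂ x : ℂˣ) : ℂ)) :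
    Continuous (cmXiTorusChar L v μv η₁ η₂ : ↥(torusU (conjLocal L (IsCMField.complexConj L) v) (cmLocalForm L 3 v)) → ℂˣ) :=
  continuous_unitsHom_of_continuous_val _ (continuous_cmXiTorusChar_apply L v μv η₁ η₂ hμc h1c h2c)

/-- **«XI-CONT★» — the `hχ` input of ★ p849929 at `χ_ξ`**: for a Hecke character `μ` of `L` and `ξ = (η, ψ) ∈ OneDimAutRepH L`, the character
`χ_ξ = cmXiTorusChar L v μ_v ξ.η_v ξ.ψ_v` of `T₃ = (cmBorelTriple L 3 v).M` is continuous at `1` as a map into `ℂˣ` (★ `continuous_semilocalComponent`, ★ `continuous_torusLocalComponent`).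
[cite: Rogawski1990, §12.2 (2) p. 174] [cite: TateThesis1967, §2.3] -/
theorem continuousAt_cmXiTorusChar_one (μ : HeckeCharacter L) (ξ : OneDimAutRepH L) :
    ContinuousAt ((cmXiTorusChar L v (μ.semilocalComponent L v) (torusLocalComponent L (IsCMField.complexConj L) v ξ.η)
        (torusLocalComponent L (IsCMField.complexConj L) v ξ.ψ) : ↥(cmBorelTriple L 3 v).M →* ℂˣ) : ↥(cmBorelTriple L 3 v).M → ℂˣ) 1 :=
  (continuous_cmXiTorusChar L v (μ.semilocalComponent L v) (torusLocalComponent L (IsCMField.complexConj L) v ξ.η)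
    (torusLocalComponent L (IsCMField.complexConj L) v ξ.ψ) (Units.continuous_val.comp (continuous_semilocalComponent L μ))
    (continuous_torusLocalComponent L (IsCMField.complexConj L) ξ.η) (continuous_torusLocalComponent L (IsCMField.complexConj L) ξ.ψ)).continuousAt

/-- The same for ANY continuous data `(μ_v, η₁, η₂)` (general `χ = cmXiTorusChar L v μv η₁ η₂`, at every point). [cite: Rogawski1990, §12.2 (2) p. 174] -/
theorem continuousAt_cmXiTorusChar (μv : (LocalRing L v)ˣ →* ℂˣ) (η₁ η₂ : ↥(normOneUnits (conjLocal L (IsCMField.complexConj L) v)) →* ℂˣ)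
    (hμc : Continuous fun x => ((μv x : ℂˣ) : ℂ)) (h1c : Continuous fun x => ((η₁ x : ℂˣ) : ℂ)) (h2c : Continuous fun x => ((η₂ x : ℂˣ) : ℂ))
    (t₀ : ↥(cmBorelTriple L 3 v).M) :
    ContinuousAt ((cmXiTorusChar L v μv η₁ η₂ : ↥(cmBorelTriple L 3 v).M →* ℂˣ) : ↥(cmBorelTriple L 3 v).M → ℂˣ) t₀ :=
  (continuous_cmXiTorusChar L v μv η₁ η₂ hμc h1c h2c).continuousAt

/-! ## §2 `T₃` is a non-archimedean group -/

/-- **«M-NONARCH★» — `T₃ = (cmBorelTriple L 3 v).M` is a non-archimedean topological group** (every neighbourhood of `1` contains an open subgroup: ★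
`exists_isOpen_subgroup_subset_cmBorelM`, from ★ `nonarchimedeanGroup_cmLocal`).  Stated as a THEOREM (no `instance`); consumers write `haveI := nonarchimedeanGroup_cmBorelM L v`.
[cite: PlatonovRapinchuk1994, §3.3] [cite: Rogawski1990, §12.7 Lemma 12.7.3 (proof) p. 195] -/
theorem nonarchimedeanGroup_cmBorelM : NonarchimedeanGroup ↥(cmBorelTriple L 3 v).M where
  is_nonarchimedean U hU := by
    obtain ⟨C, hCo, hCU⟩ := F0P3cStCharTSShellOrbitalG.exists_isOpen_subgroup_subset_cmBorelM L v U hU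
    exact ⟨⟨C, hCo⟩, hCU⟩

end Summit.HodgeConjecture.HodgeConjecture.Cruxes.H413.F0P3cStCharTSXiCont

end
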